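import Literature.Probability.LatticeModels.DartPhase
import Literature.Probability.LatticeModels.DirichletGreenFunction
import Literature.Probability.RandomPlanarGeometry.PlanarDomains
import Summits.CriticalPhenomena.CardyFormulaZ2.Theorems.CardySusyWardParafermionPrecompactKenyonDefs
import Summits.CriticalPhenomena.CardyFormulaZ2.Theorems.CardySusyWardParafermionPrecompactCodedCycleTransport
import Summits.CriticalPhenomena.CardyFormulaZ2.Theorems.CardySusyWardParafermionPrecompactInnerCycleWinding
import Literature.Probability.LatticeModels.SHolomorphicityProof

/-!
# The orientation of the loop excised by the one-edge involution (helper for stub `stub_vertexRelation`)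

Line `kenyon-stream-second-relation` of the crux `ParafermionPrecompact` (route `CardySusyWard`,
item stmt-CriticalPhenomena-11293). The topological input of the vertex relation of
Duminil-Copin–Smirnov 2012, Prop. 8.6 (= Duminil-Copin 2012, Prop. 4) at `q = 1`, spin `1/3`,
which Smirnov's `σ = 1/2` computation (the tree's `PairIdentities.lean`) does not need: when the
exploration of `ω` arrives at an interior edge `e` through both darts of `e` (times `i₁ < i₂`), the
stretch in between is a cycle of the TOGGLED turning rule (`cornerOrbit_toggle_case2`), and its
turn-sign sum is `-4` (clockwise) if it FOLLOWS `e` in the toggled configuration and `+4`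
(counter-clockwise) if it CROSSES `e` (`excisedLoop_turnSign_sum`, registered helper). At
`σ = 1/3` the phase of the second arrival is `e^{∓iπ/3}·e^{…}` accordingly; with the wrong sign the
vertex relation fails (annular counterexample of the refuters, evidence on the item), which is why
the stub was reshaped to Jordan carriers `E.Ω = D.carrier`.

Proof: by the orientation dichotomy (`medialCycle_orientation_dichotomy`) the sign is decided by
the right winding number `R` of the coded loop; the fine face of the vertex `p.1` of the first
arriving dart has winding number `R + 1` in the first case (it is a left vertex of the loop,
`coded_W_vFace`) and `R` in the second (it is diagonal to the common face across the absent corner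
`p`, `coded_W_fFace`, `coded_W_vFace_eq_fFace_of_notMem`); and that winding number is `0`: `p.1`
is joined to the start vertex `c₀.1` by the open left chain of the toggled exploration
(`cornerOrbit_fst_reachable`, `coded_W_vFace_of_mem`), `c₀.1` is a corner of the non-inner outer
face of `e_a`, whose corner at `c₀.1` is not on the (inner) loop, and an inner loop does not wind
around a non-inner face of a Jordan domain (`codedCycle_W_eq_zero_of_not_isInnerFace`).

References: H. Duminil-Copin, S. Smirnov, Clay Math. Proc. 15 (2012), §8.3 Prop. 8.6
[DuminilCopinSmirnov2012Lattice]; S. Smirnov, Ann. of Math. 172 (2010), §4 [Smirnov2010].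
-/

noncomputable section

namespace Summit.CriticalPhenomena.CardyFormulaZ2.Cruxes.ParafermionPrecompact.KenyonStreamSecondRelation

open Finset
open _root_.Literature.Topology.PlaneTopology _root_.Literature.Topology.PlaneTopology.RectLoop
open _root_.Literature.Probability.LatticeModels
open _root_.Literature.Probability.Percolation (BondConfig bondPercolation half)
open _root_.Literature.Probability.RandomPlanarGeometry (DobrushinDomain)

/-! ## The orientation of the loop excised by the one-edge involution -/

section Orientation

open _root_.Literature.Topology.PlaneTopology.RectLoop (code codeOff dir)
open SimpleGraph
open _root_.Literature.Probability (Percolation.openGraph Percolation.openGraph_adj)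

variable {E : DiscreteDobrushin}

/-- **Open paths do not separate left vertices** (walk form of `coded_W_vFace_of_mem`): the fine
faces of two sites joined by a path of open edges of a completed configuration have the same
winding number with respect to the coded walk of any cycle of its turning rule. [folklore] -/
theorem coded_W_vFace_eq_of_reachable {ω : BondConfig (Site 2)} {q : Site 2 × Fin 4} {Q : ℕ}
    (c : ClosedWalk Q) (hc : ∀ m, c.v m = code (cornerOrbit (E.bcBondConfig ω) q m)) {a b : Site 2}
    (h : (Percolation.openGraph (E.bcBondConfig ω)).Reachable a b) :
    c.W (2 * a 0 - 1, 2 * a 1 - 1) = c.W (2 * b 0 - 1, 2 * b 1 - 1) := by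
  obtain ⟨w⟩ := h
  induction w with
  | nil => rfl
  | @cons x y z hxy _ ih =>
    refine Eq.trans ?_ ih
    rw [Percolation.openGraph_adj] at hxy
    have hadj : (zdGraph 2).Adj x y := by
      have := bcBondConfig_subset_zd (D := E) ω hxy.1
      rwa [SimpleGraph.mem_edgeSet] at this
    obtain ⟨k, rfl⟩ := exists_eq_add_cornerUnit hadj
    exact coded_W_vFace_of_mem _ q Q c hc x k hxy.1

/-- **Orientation of the excised loop** (registered helper of `stub_vertexRelation`; the
topological input of DCS 2012, Prop. 8.6 at `q = 1`, absent from Smirnov's `σ = 1/2` computation).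
Let the domain of the admissible datum `E` be a Jordan domain, let the exploration of `ω` (orbit
of the start corner `c₀`, inner faces before time `N`) arrive at the edge `e = cTgt p` through `p`
at time `i₁` and through its partner at time `i₂`, `i₁ < i₂ < N`, and let `ω'` be the toggled
configuration (completions agreeing off `e`, differing at `e`). Then the stretch
`orb (i₁+1), …, orb i₂` — a cycle of the toggled turning rule — turns by `-4` (clockwise) if it
FOLLOWS `e` in the toggled configuration (`e` open there) and by `+4` (counter-clockwise) if it
CROSSES `e`. Proof: by the orientation dichotomy the sign is read off the winding number of the
coded loop about the fine face of the vertex `p.1` (a left vertex of the loop in the first case,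
diagonal to a right face across the absent corner `p` in the second), and that winding number
vanishes: `p.1` is joined to the start vertex `c₀.1` by the open left chain of the toggled
exploration, `c₀.1` is a corner of the non-inner outer face of `e_a`, whose corner at `c₀.1` is
not on the (inner) loop, and an inner loop does not wind around a non-inner face of a Jordan
domain (`codedCycle_W_eq_zero_of_not_isInnerFace`).
[cite: DuminilCopinSmirnov2012Lattice, §8.3 Prop. 8.6] -/
theorem excisedLoop_turnSign_sum :
    ∀ (D : DobrushinDomain) (E : DiscreteDobrushin), E.Ω = D.carrier → E.IsZdAdmissible →
      ∀ (ω ω' : BondConfig (Site 2)) (c₀ p : Site 2 × Fin 4), E.IsStartCorner c₀ →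
        (∀ f, f ≠ cTgt p → (f ∈ E.bcBondConfig ω' ↔ f ∈ E.bcBondConfig ω)) →
        ¬ (cTgt p ∈ E.bcBondConfig ω' ↔ cTgt p ∈ E.bcBondConfig ω) →
          ∀ (N i₁ i₂ : ℕ), (∀ k < N, E.IsInnerFace (cFace (cornerOrbit (E.bcBondConfig ω) c₀ k))) →
            cornerOrbit (E.bcBondConfig ω) c₀ i₁ = p →
            cornerOrbit (E.bcBondConfig ω) c₀ i₂ = cornerPartner p → i₁ < i₂ → i₂ < N →
              (cTgt p ∈ E.bcBondConfig ω' →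
                ∑ m ∈ Finset.range (i₂ - i₁),
                  turnSign (E.bcBondConfig ω') (cornerOrbit (E.bcBondConfig ω) c₀ (i₁ + 1 + m)) = -4) ∧
              (cTgt p ∉ E.bcBondConfig ω' →
                ∑ m ∈ Finset.range (i₂ - i₁),
                  turnSign (E.bcBondConfig ω') (cornerOrbit (E.bcBondConfig ω) c₀ (i₁ + 1 + m)) = 4) := by
  intro D E hΩ hE ω ω' c₀ p hc₀ hagree hdiff N i₁ i₂ hlt hi₁ hi₂ h12 hi₂N
  set β := E.bcBondConfig ω with hβ
  set β' := E.bcBondConfig ω' with hβ'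
  have hδ : 0 < E.δ := hE.delta_pos
  have hinj : ∀ a b, a < N → b < N → cornerOrbit β c₀ a = cornerOrbit β c₀ b → a = b := by
    intro a b ha hb h
    by_contra hne
    rcases Nat.lt_or_gt_of_ne hne with hab | hab
    · exact cornerOrbit_ne hE hc₀ hab (fun k hk => hlt k (by omega)) h
    · exact cornerOrbit_ne hE hc₀ hab (fun k hk => hlt k (by omega)) h.symm
  obtain ⟨hpre, -⟩ := cornerOrbit_toggle_case2 hE hc₀ hagree hdiff hlt hi₁ hi₂ h12 hi₂N
  -- the excised stretch is a cycle of the toggled rule of minimal period `i₂ - i₁`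
  set m₀ := cornerOrbit β c₀ (i₁ + 1) with hm₀
  have hm₀' : m₀ = nextCorner β p := by rw [hm₀, ← hi₁]; rfl
  have hcyc : ∀ m, m + 1 ≤ i₂ - i₁ → cornerOrbit β' m₀ m = cornerOrbit β c₀ (i₁ + 1 + m) := by
    intro m hm
    induction m with
    | zero => rfl
    | succ m ih =>
      change nextCorner β' (cornerOrbit β' m₀ m) = _
      rw [ih (by omega), show i₁ + 1 + (m + 1) = (i₁ + 1 + m) + 1 by omega, cornerOrbit_succ]
      refine nextCorner_toggle_of_ne hagree hdiff (fun h => ?_) (fun h => ?_)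
      · have := hinj _ i₁ (by omega) (by omega) (h.trans hi₁.symm); omega
      · have := hinj _ i₂ (by omega) hi₂N (h.trans hi₂.symm); omega
  set Qm := i₂ - i₁ with hQm
  have hQ0 : 0 < Qm := by omega
  have hclose : cornerOrbit β' m₀ Qm = m₀ := by
    rw [show Qm = (Qm - 1) + 1 by omega]
    change nextCorner β' (cornerOrbit β' m₀ (Qm - 1)) = _
    rw [hcyc (Qm - 1) (by omega), show i₁ + 1 + (Qm - 1) = i₂ by omega, hi₂, nextCorner_toggle hagree hdiff,
      Equiv.swap_apply_right, ← hi₁, ← cornerOrbit_succ]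
  have hmin : ∀ s, 0 < s → s < Qm → cornerOrbit β' m₀ s ≠ m₀ := by
    intro s hs hsM h
    rw [hcyc s (by omega)] at h
    have := hinj _ _ (by omega) (by omega) h
    omega
  have horbM : ∀ m, cornerOrbit β' m₀ m = cornerOrbit β c₀ (i₁ + 1 + m % Qm) := by
    intro m
    rw [← cornerOrbit_mod_period hclose m, hcyc (m % Qm) (Nat.mod_lt _ hQ0)]
  have hidx : ∀ m, i₁ + 1 + m % Qm < N := fun m => by have := Nat.mod_lt m hQ0; omega
  have hinnerM : ∀ m, E.IsInnerFace (cFace (cornerOrbit β' m₀ m)) := fun m => by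
    rw [horbM]; exact hlt _ (hidx m)
  -- its coded closed walk
  let c : ClosedWalk Qm :=
    { v := fun m => code (cornerOrbit β' m₀ m)
      periodic := fun m => by
        show code (cornerOrbit β' m₀ (m + Qm)) = code (cornerOrbit β' m₀ m)
        rw [cornerOrbit_add_period hclose]
      adj := fun m => exists_code_nextCorner (β := β') (cornerOrbit β' m₀ m) }
  have hc : ∀ m, c.v m = code (cornerOrbit β' m₀ m) := fun m => rfl
  have hdich := medialCycle_orientation_dichotomy β' m₀ Qm hQ0 hclose hmin c hc
  have hsum : ∑ m ∈ Finset.range (i₂ - i₁), turnSign β' (cornerOrbit β c₀ (i₁ + 1 + m)) =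
      ∑ m ∈ Finset.range Qm, turnSign β' (cornerOrbit β' m₀ m) := by
    refine Finset.sum_congr rfl fun m hm => ?_
    rw [Finset.mem_range] at hm
    rw [hcyc m (by omega)]
  rw [hsum]
  -- the winding number of the fine face of `p.1` vanishes
  have hW0 : c.W (2 * p.1 0 - 1, 2 * p.1 1 - 1) = 0 := by
    -- `p.1` is joined to `c₀.1` by the open left chain of the toggled exploration
    have hreach : (Percolation.openGraph β').Reachable c₀.1 p.1 := by
      have := cornerOrbit_fst_reachable β' c₀ (Nat.zero_le i₁)
      rwa [cornerOrbit_zero, hpre i₁ le_rfl, hi₁] at this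
    rw [← coded_W_vFace_eq_of_reachable c hc hreach]
    -- the corner of the outer face of `e_a` at `c₀.1` is not on the (inner) loop
    have hoff : ∀ m, cornerOrbit β' m₀ m ≠ (c₀.1, c₀.2 + 3) := by
      intro m h
      have := hinnerM m
      rw [h] at this
      exact hc₀.isOutEdge.2 this
    rw [coded_W_vFace_eq_fFace_of_notMem c hc hoff]
    exact codedCycle_W_eq_zero_of_not_isInnerFace D E hΩ hδ β' m₀ Qm hQ0 hclose hinnerM
      (faceAt c₀.1 (c₀.2 + 3)) c₀.1 hc₀.isOutEdge.2 (isCorner_faceAt _ _)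
      (E.zdBoundary_subset_meshDomain (E.zdArcA_subset_zdBoundary hc₀.mem_zdArcA)) c hc
  constructor
  · -- `e` open in the toggled configuration: the loop follows `e` from the partner into `p.1`
    intro he'
    have he : cTgt p ∉ β := fun h => hdiff ⟨fun _ => h, fun _ => he'⟩
    have hv : (cornerOrbit β' m₀ 0).1 = p.1 := by
      change m₀.1 = p.1
      rw [hm₀', nextCorner_of_not_mem he]
    have hL := coded_W_vFace c hc hQ0 hclose hmin 0
    rw [hv, hW0] at hL
    rcases hdich with ⟨-, hR⟩ | ⟨hT, -⟩
    · rw [hR] at hL; norm_num at hL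
    · exact hT
  · -- `e` closed in the toggled configuration: the loop crosses `e`; `p` is off the loop
    intro he'
    have he : cTgt p ∈ β := by
      by_contra h; exact hdiff ⟨fun h' => absurd h' he', fun h' => absurd h' h⟩
    have hf : cFace (cornerOrbit β' m₀ 0) = cFace p := by
      change cFace m₀ = cFace p
      rw [hm₀', cFace_nextCorner_of_mem he]
    have hR' := coded_W_fFace c hc hQ0 hclose hmin 0
    rw [hf] at hR'
    have hoffp : ∀ m, cornerOrbit β' m₀ m ≠ p := by
      intro m h
      rw [horbM, ← hi₁] at h
      have := hinj _ _ (hidx m) (by omega) h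
      omega
    have hp : p = (p.1, p.2) := rfl
    rw [hp] at hoffp
    have hL := coded_W_vFace_eq_fFace_of_notMem c hc hoffp
    rw [hW0] at hL
    change (0 : ℤ) = c.W (2 * cFace p 0, 2 * cFace p 1) at hL
    rw [hR'] at hL
    rcases hdich with ⟨hT, -⟩ | ⟨-, hR⟩
    · exact hT
    · rw [hR] at hL; norm_num at hL

end Orientation

end Summit.CriticalPhenomena.CardyFormulaZ2.Cruxes.ParafermionPrecompact.KenyonStreamSecondRelation

end
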